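import Literature.MathematicalPhysics.QuantumFieldTheory.LatticeLangevinDynamics
import Mathlib.Analysis.Matrix.Normed
import Mathlib.Analysis.SpecialFunctions.Exponential
import Mathlib.Topology.Algebra.Module.FiniteDimension
import Mathlib.Algebra.Algebra.Operations
import HarnessLib

/-!
# Route `ColdStartUniversality`, support item S (stmt-QuantumFields-24811), line `piwiener`:
# the SZZ coefficients are tangent to the Frobenius spheres (Itô-corrected) and live in the real
# span of the group

Helper file (lead `ym-line-csu-p1`) for the registered stub `stub_coldStartStrongExistence` (cold-start
strong existence of the lattice Langevin dynamics `latticeLangevinDynamics r β`, SZZ arXiv:2204.12737 §3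
(⋆)).  Two purely algebraic inputs of the existence proof (Picard iteration for globally Lipschitz
MODIFIED coefficients in the ambient matrix space `M_N(ℂ)^E`, then invariance of the group), valid for
EVERY lattice representation `r : LatticeRep G`:

* **the real span of the group is an invariant subalgebra.**  `V_r := Submodule.span ℝ (range ρ)` is a
  unital real subalgebra of `M_N(ℂ)` (`one_mem_spanRange`, `mul_mem_spanRange`), closed
  (`isClosed_spanRange`), and contains the embedded Lie algebra: `lieAlgCarrier r ⊆ V_r`
  (`X = lim_{t→0} t⁻¹(exp(tX) − 1)` with `exp(tX) ∈ ρ(G) ⊆ V_r`, by the derivative of the matrix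
  exponential — no `det ∘ exp` needed), hence `lieAlg r ≤ V_r`, `𝐩 X ∈ V_r`, `driftLie ∈ V_r`,
  `C_𝔤 ∈ V_r`, and the drift / noise coefficients of (⋆) map `V_r^E` into `V_r`
  (`drift_mem_spanRange`, `noise_mem_spanRange`).  For `SU(2)` (fundamental) `V_r` is the quaternion
  4-plane `ℍ ⊂ M₂(ℂ)`, whose unit Frobenius-sphere `{‖Q‖_F² = 2}` IS `SU(2)` (sibling file);
* **tangency, Itô-corrected.**  With `⟨X, Y⟩ = Re tr(X Yᴴ)` (`hsForm`): `Re tr(A H) = 0` for `A`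
  skew-Hermitian and `H` Hermitian (`re_trace_mul_eq_zero_of_skew_herm`), so `⟨A Q, Q⟩ = 0` for
  `A ∈ 𝔤` (`hsForm_mul_left_eq_zero_of_mem_lieAlg`); the noise coefficients `σ_{e,n}(Q) = √2 𝐩(Eₙ) Q_e`
  satisfy `⟨σ_{e,n}(Q), Q_e⟩ = 0` (`hsForm_noise_self`) and the Itô correction identity
  `Σₙ ⟨σ_{e,n}, σ_{e,n}⟩ = −2 ⟨C_𝔤 Q_e, Q_e⟩` (`sum_hsForm_noise_noise`; cyclicity of the trace and
  `𝐩(Eₙ)ᴴ = −𝐩(Eₙ)`), whence for ANY drift of the form `(A·(φ Q_e) + C_𝔤 Q_e)` with `A ∈ 𝔤`, `φ ∈ ℝ`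
  (the true drift: `φ = 1`, `A = driftLie β Q e`; the modified one: `A` evaluated at truncated
  arguments, `φ` the radial truncation factor): `2⟨drift, Q_e⟩ + Σₙ ‖σ_{e,n}‖² = 0`
  (`two_hsForm_drift_add_sum_noise_sq_eq_zero`) — `d‖Q_e‖_F² = 0` along (⋆) by Itô's product rule.

No definition, no sorry, standard axioms.  RECORD-rung plumbing; nothing here bears on the mass gap.
-/

set_option autoImplicit false

noncomputable section

namespace Summit.QuantumFields.YangMills.Theorems.ColdStartUniversality

open Matrix Complex Finset Filter Topology
open scoped ComplexConjugate BigOperators Pointwise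
open Literature.MathematicalPhysics.QuantumFieldTheory

variable {G : Type*} [Group G] [TopologicalSpace G] (r : LatticeRep G)

/-! ### The real span of `ρ(G)` -/

/-- `ρ(g)` lies in the real span of `ρ(G)`. [folklore] -/
theorem rho_mem_spanRange (g : G) :
    r.ρ g ∈ Submodule.span ℝ (Set.range (r.ρ : G → Matrix (Fin r.N) (Fin r.N) ℂ)) :=
  Submodule.subset_span ⟨g, rfl⟩

/-- `1 = ρ(1)` lies in the real span of `ρ(G)`. [folklore] -/
theorem one_mem_spanRange :
    (1 : Matrix (Fin r.N) (Fin r.N) ℂ) ∈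
      Submodule.span ℝ (Set.range (r.ρ : G → Matrix (Fin r.N) (Fin r.N) ℂ)) := by
  simpa using rho_mem_spanRange r 1

/-- **The real span of `ρ(G)` is a subalgebra**: closed under matrix multiplication (`ρ(G)` is a
group of matrices). [folklore] -/
theorem mul_mem_spanRange {x y : Matrix (Fin r.N) (Fin r.N) ℂ}
    (hx : x ∈ Submodule.span ℝ (Set.range (r.ρ : G → Matrix (Fin r.N) (Fin r.N) ℂ)))
    (hy : y ∈ Submodule.span ℝ (Set.range (r.ρ : G → Matrix (Fin r.N) (Fin r.N) ℂ))) :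
    x * y ∈ Submodule.span ℝ (Set.range (r.ρ : G → Matrix (Fin r.N) (Fin r.N) ℂ)) := by
  have hsub : Set.range (r.ρ : G → Matrix (Fin r.N) (Fin r.N) ℂ) *
      Set.range (r.ρ : G → Matrix (Fin r.N) (Fin r.N) ℂ) ⊆ Set.range (r.ρ : G → _) := by
    rintro _ ⟨_, ⟨g, rfl⟩, _, ⟨h, rfl⟩, rfl⟩
    exact ⟨g * h, (map_mul r.ρ g h)⟩
  have h := Submodule.mul_mem_mul hx hy
  rw [Submodule.span_mul_span] at h
  exact Submodule.span_mono hsub h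

/-- Sums of products stay in the span (used for the Casimir matrix). [folklore] -/
theorem sum_mul_mem_spanRange {ι : Type*} (s : Finset ι) {f g : ι → Matrix (Fin r.N) (Fin r.N) ℂ}
    (hf : ∀ i ∈ s, f i ∈ Submodule.span ℝ (Set.range (r.ρ : G → Matrix (Fin r.N) (Fin r.N) ℂ)))
    (hg : ∀ i ∈ s, g i ∈ Submodule.span ℝ (Set.range (r.ρ : G → Matrix (Fin r.N) (Fin r.N) ℂ))) :
    ∑ i ∈ s, f i * g i ∈ Submodule.span ℝ (Set.range (r.ρ : G → Matrix (Fin r.N) (Fin r.N) ℂ)) :=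
  Submodule.sum_mem _ fun i hi => mul_mem_spanRange r (hf i hi) (hg i hi)

/-- The real span of `ρ(G)` is closed in `M_N(ℂ)` (a finite-dimensional real subspace). [folklore] -/
theorem isClosed_spanRange :
    IsClosed (Submodule.span ℝ (Set.range (r.ρ : G → Matrix (Fin r.N) (Fin r.N) ℂ)) :
      Set (Matrix (Fin r.N) (Fin r.N) ℂ)) :=
  Submodule.closed_of_finiteDimensional _

/-- **The embedded Lie algebra lies in the real span of the group**: if `exp(tX) ∈ ρ(G)` for all real
`t`, then `X = lim_{t → 0} t⁻¹ (exp(tX) − 1) ∈ V_r` (derivative of `t ↦ exp(tX)` at `0` in the Banach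
algebra `M_N(ℂ)` with the Frobenius norm; `V_r` is closed and contains `exp(tX)` and `1`).  Avoids
`det ∘ exp = exp ∘ tr`.  Hall, *Lie Groups, Lie Algebras, and Representations* (2015), Def. 3.18,
Cor. 3.46. -/
theorem lieAlgCarrier_subset_spanRange :
    r.lieAlgCarrier ⊆ Submodule.span ℝ (Set.range (r.ρ : G → Matrix (Fin r.N) (Fin r.N) ℂ)) := by
  intro X hX
  letI : NormedRing (Matrix (Fin r.N) (Fin r.N) ℂ) := Matrix.frobeniusNormedRing
  letI : NormedAlgebra ℝ (Matrix (Fin r.N) (Fin r.N) ℂ) := Matrix.frobeniusNormedAlgebra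
  have hd : HasDerivAt (fun u : ℝ => NormedSpace.exp (u • X)) (NormedSpace.exp ((0 : ℝ) • X) * X) 0 :=
    hasDerivAt_exp_smul_const X 0
  rw [zero_smul, NormedSpace.exp_zero, one_mul] at hd
  have ht := hd.tendsto_slope_zero
  refine (isClosed_spanRange r).mem_of_tendsto ht (Filter.Eventually.of_forall fun t => ?_)
  simp only [zero_add, zero_smul, NormedSpace.exp_zero]
  refine Submodule.smul_mem _ _ (Submodule.sub_mem _ ?_ (one_mem_spanRange r))
  obtain ⟨g, hg⟩ := hX.2 t
  rw [← hg]
  exact rho_mem_spanRange r g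

/-- Hence `𝔤 = span(lieAlgCarrier) ≤ V_r`. [folklore] -/
theorem lieAlg_le_spanRange :
    r.lieAlg ≤ Submodule.span ℝ (Set.range (r.ρ : G → Matrix (Fin r.N) (Fin r.N) ℂ)) :=
  Submodule.span_le.2 (lieAlgCarrier_subset_spanRange r)

/-- `𝐩 X ∈ V_r` for every `X`. [folklore] -/
theorem lieProj_mem_spanRange (X : Matrix (Fin r.N) (Fin r.N) ℂ) :
    r.lieProj X ∈ Submodule.span ℝ (Set.range (r.ρ : G → Matrix (Fin r.N) (Fin r.N) ℂ)) :=
  lieAlg_le_spanRange r (r.lieProj_mem X)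

/-- The right-trivialised drift `β Σ_{p ≻ e} 𝐩(Q_pᴴ)` lies in `V_r` (for ANY configuration `Q`).
[folklore] -/
theorem driftLie_mem_spanRange {d L : ℕ} (β : ℝ) (Q : MatrixConfig d L r.N) (e : Edge d L) :
    r.driftLie β Q e ∈ Submodule.span ℝ (Set.range (r.ρ : G → Matrix (Fin r.N) (Fin r.N) ℂ)) :=
  lieAlg_le_spanRange r (r.driftLie_mem_lieAlg β Q e)

/-- The Casimir matrix `C_𝔤 = Σₙ 𝐩(Eₙ)²` lies in `V_r`. [folklore] -/
theorem casimir_mem_spanRange :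
    r.casimir ∈ Submodule.span ℝ (Set.range (r.ρ : G → Matrix (Fin r.N) (Fin r.N) ℂ)) :=
  sum_mul_mem_spanRange r _ (fun _ _ => lieProj_mem_spanRange r _)
    (fun _ _ => lieProj_mem_spanRange r _)

/-- A complex scalar which is real acts on `V_r`: `(c : ℂ) • x ∈ V_r` for `x ∈ V_r`. [folklore] -/
theorem coe_smul_mem_spanRange (c : ℝ) {x : Matrix (Fin r.N) (Fin r.N) ℂ}
    (hx : x ∈ Submodule.span ℝ (Set.range (r.ρ : G → Matrix (Fin r.N) (Fin r.N) ℂ))) :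
    (c : ℂ) • x ∈ Submodule.span ℝ (Set.range (r.ρ : G → Matrix (Fin r.N) (Fin r.N) ℂ)) := by
  have h : (c : ℂ) • x = c • x := by
    ext i j
    simp [Matrix.smul_apply, Complex.real_smul]
  rw [h]
  exact Submodule.smul_mem _ c hx

/-- **The drift of (⋆) maps `V_r^E` into `V_r`**: `(driftLie + C_𝔤) Q_e ∈ V_r` whenever `Q_e ∈ V_r`.
[folklore] -/
theorem drift_mem_spanRange {d L : ℕ} (β : ℝ) (Q : MatrixConfig d L r.N) (e : Edge d L)
    (hQ : Q e ∈ Submodule.span ℝ (Set.range (r.ρ : G → Matrix (Fin r.N) (Fin r.N) ℂ))) :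
    (latticeLangevinDynamics r β).drift Q e ∈
      Submodule.span ℝ (Set.range (r.ρ : G → Matrix (Fin r.N) (Fin r.N) ℂ)) := by
  rw [latticeLangevinDynamics_drift]
  exact mul_mem_spanRange r (Submodule.add_mem _ (driftLie_mem_spanRange r β Q e)
    (casimir_mem_spanRange r)) hQ

/-- **The noise coefficients of (⋆) map `V_r^E` into `V_r`**: `√2 𝐩(Eₙ) Q_e ∈ V_r` whenever
`Q_e ∈ V_r`. [folklore] -/
theorem noise_mem_spanRange {d L : ℕ} (β : ℝ) (Q : MatrixConfig d L r.N) (e : Edge d L)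
    (n : NoiseIdx r.N)
    (hQ : Q e ∈ Submodule.span ℝ (Set.range (r.ρ : G → Matrix (Fin r.N) (Fin r.N) ℂ))) :
    (latticeLangevinDynamics r β).noise Q e n ∈
      Submodule.span ℝ (Set.range (r.ρ : G → Matrix (Fin r.N) (Fin r.N) ℂ)) := by
  rw [latticeLangevinDynamics_noise]
  exact coe_smul_mem_spanRange r _ (mul_mem_spanRange r (lieProj_mem_spanRange r _) hQ)

/-! ### Tangency to the Frobenius spheres, Itô-corrected -/

section Tangency

variable {N : ℕ}

/-- `Re tr(A H) = 0` for `A` skew-Hermitian and `H` Hermitian (`tr(AH)` is purely imaginary: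
`conj tr(AH) = tr((AH)ᴴ) = tr(H(−A)) = −tr(AH)`). [folklore] -/
theorem re_trace_mul_eq_zero_of_skew_herm {A H : Matrix (Fin N) (Fin N) ℂ} (hA : star A = -A)
    (hH : star H = H) : (A * H).trace.re = 0 := by
  have h1 : star (A * H).trace = -(A * H).trace := by
    rw [← Matrix.trace_conjTranspose, Matrix.conjTranspose_mul]
    change (star H * star A).trace = _
    rw [hA, hH, Matrix.mul_neg, Matrix.trace_neg, Matrix.trace_mul_comm]
  have h2 := congrArg Complex.re h1
  rw [Complex.star_def, Complex.conj_re, Complex.neg_re] at h2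
  linarith

/-- `⟨A Q, Q⟩ = Re tr(A Q Qᴴ) = 0` for skew-Hermitian `A` (`Q Qᴴ` is Hermitian). [folklore] -/
theorem hsForm_mul_left_eq_zero_of_skew {A : Matrix (Fin N) (Fin N) ℂ} (hA : star A = -A)
    (Q : Matrix (Fin N) (Fin N) ℂ) : hsForm N (A * Q) Q = 0 := by
  rw [hsForm_apply, Matrix.mul_assoc]
  refine re_trace_mul_eq_zero_of_skew_herm hA ?_
  change (Q * Qᴴ)ᴴ = Q * Qᴴ
  rw [Matrix.conjTranspose_mul, Matrix.conjTranspose_conjTranspose]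

/-- `⟨A Q, Q⟩ = 0` for `A ∈ 𝔤` (elements of the embedded Lie algebra are skew-Hermitian). [folklore] -/
theorem hsForm_mul_left_eq_zero_of_mem_lieAlg {A : Matrix (Fin r.N) (Fin r.N) ℂ}
    (hA : A ∈ r.lieAlg) (Q : Matrix (Fin r.N) (Fin r.N) ℂ) : hsForm r.N (A * Q) Q = 0 :=
  hsForm_mul_left_eq_zero_of_skew (r.star_eq_neg_of_mem_lieAlg hA) Q

/-- Real scalars come out of the first argument of `hsForm` (even when written as complex scalars).
[folklore] -/
theorem hsForm_coe_smul_left (c : ℝ) (X Y : Matrix (Fin N) (Fin N) ℂ) :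
    hsForm N ((c : ℂ) • X) Y = c * hsForm N X Y := by
  rw [hsForm_apply, hsForm_apply, Matrix.smul_mul, Matrix.trace_smul, smul_eq_mul,
    Complex.re_ofReal_mul]

/-- Real scalars come out of the second argument of `hsForm`. [folklore] -/
theorem hsForm_coe_smul_right (c : ℝ) (X Y : Matrix (Fin N) (Fin N) ℂ) :
    hsForm N X ((c : ℂ) • Y) = c * hsForm N X Y := by
  rw [hsForm_comm, hsForm_coe_smul_left, hsForm_comm]

/-- Real (`ℝ`-module) scalars come out of the first argument of `hsForm`. [folklore] -/
theorem hsForm_real_smul_left (c : ℝ) (X Y : Matrix (Fin N) (Fin N) ℂ) :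
    hsForm N (c • X) Y = c * hsForm N X Y := by
  rw [map_smul (hsForm N), LinearMap.smul_apply, smul_eq_mul]

/-- **The noise is tangent to the Frobenius spheres**: `⟨σ_{e,n}(Q), Q_e⟩ = √2 Re tr(𝐩(Eₙ) Q_e Q_eᴴ) = 0`.
[folklore] -/
theorem hsForm_noise_self {d L : ℕ} (β : ℝ) (Q : MatrixConfig d L r.N) (e : Edge d L)
    (n : NoiseIdx r.N) :
    hsForm r.N ((latticeLangevinDynamics r β).noise Q e n) (Q e) = 0 := by
  rw [latticeLangevinDynamics_noise, hsForm_coe_smul_left,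
    hsForm_mul_left_eq_zero_of_mem_lieAlg r (r.lieProj_mem _), mul_zero]

/-- `⟨P Q, P Q⟩ = −Re tr(P P Q Qᴴ) = −⟨(P P) Q, Q⟩` for skew-Hermitian `P` (cyclicity of the trace).
[folklore] -/
theorem hsForm_mul_mul_self_of_skew {P : Matrix (Fin N) (Fin N) ℂ} (hP : star P = -P)
    (Q : Matrix (Fin N) (Fin N) ℂ) : hsForm N (P * Q) (P * Q) = -hsForm N (P * P * Q) Q := by
  rw [hsForm_apply, hsForm_apply, Matrix.conjTranspose_mul]
  change (P * Q * (Qᴴ * star P)).trace.re = _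
  rw [hP]
  simp only [Matrix.mul_neg, Matrix.trace_neg, Complex.neg_re]
  congr 2
  calc (P * Q * (Qᴴ * P)).trace = ((P * Q * Qᴴ) * P).trace := by rw [← Matrix.mul_assoc]
    _ = (P * (P * Q * Qᴴ)).trace := Matrix.trace_mul_comm _ _
    _ = (P * P * Q * Qᴴ).trace := by rw [← Matrix.mul_assoc, ← Matrix.mul_assoc]

/-- **The Itô correction identity**: `Σₙ ⟨σ_{e,n}(Q), σ_{e,n}(Q)⟩ = −2 ⟨C_𝔤 Q_e, Q_e⟩`
(`σ_{e,n} = √2 𝐩(Eₙ) Q_e`, `C_𝔤 = Σₙ 𝐩(Eₙ)²`, `𝐩(Eₙ)` skew-Hermitian). [folklore] -/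
theorem sum_hsForm_noise_noise {d L : ℕ} (β : ℝ) (Q : MatrixConfig d L r.N) (e : Edge d L) :
    ∑ n : NoiseIdx r.N, hsForm r.N ((latticeLangevinDynamics r β).noise Q e n)
        ((latticeLangevinDynamics r β).noise Q e n) =
      -2 * hsForm r.N (r.casimir * Q e) (Q e) := by
  have h2 : ((Real.sqrt 2 : ℝ) : ℂ) • (0 : Matrix (Fin r.N) (Fin r.N) ℂ) = 0 := smul_zero _
  simp only [latticeLangevinDynamics_noise, hsForm_coe_smul_left, hsForm_coe_smul_right]
  have hsq : Real.sqrt 2 * Real.sqrt 2 = 2 := Real.mul_self_sqrt (by norm_num)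
  calc ∑ n : NoiseIdx r.N, Real.sqrt 2 * (Real.sqrt 2 *
          hsForm r.N (r.lieProj (noiseDir n) * Q e) (r.lieProj (noiseDir n) * Q e))
      = ∑ n : NoiseIdx r.N, 2 * -hsForm r.N (r.lieProj (noiseDir n) * r.lieProj (noiseDir n) * Q e)
          (Q e) := by
        refine Finset.sum_congr rfl fun n _ => ?_
        rw [← mul_assoc, hsq, hsForm_mul_mul_self_of_skew (r.star_lieProj _)]
    _ = -2 * hsForm r.N (r.casimir * Q e) (Q e) := by
        rw [← Finset.mul_sum, Finset.sum_neg_distrib, LatticeRep.casimir, Finset.sum_mul,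
          map_sum (hsForm r.N), LinearMap.sum_apply]
        ring

/-- **Tangency of the drift, Itô-corrected — for every drift of the shape `A (φ Q_e) + C_𝔤 Q_e`** with
`A ∈ 𝔤` and `φ ∈ ℝ` (the drift of (⋆) is `φ = 1`, `A = driftLie β Q e`; the globally Lipschitz
modification used by the Picard iteration evaluates `A` at radially truncated arguments and takes for
`φ` the truncation factor): `2⟨A (φ Q_e) + C_𝔤 Q_e, Q_e⟩ + Σₙ ‖σ_{e,n}(Q)‖² = 0`.  This is
`d‖Q_e‖_F² = 0` along the dynamics (Itô's product rule). [folklore] -/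
theorem two_hsForm_drift_add_sum_noise_sq_eq_zero {d L : ℕ} (β : ℝ) (Q : MatrixConfig d L r.N)
    (e : Edge d L) {A : Matrix (Fin r.N) (Fin r.N) ℂ} (hA : A ∈ r.lieAlg) (φ : ℝ) :
    2 * hsForm r.N (A * (φ • Q e) + r.casimir * Q e) (Q e) +
      ∑ n : NoiseIdx r.N, hsForm r.N ((latticeLangevinDynamics r β).noise Q e n)
        ((latticeLangevinDynamics r β).noise Q e n) = 0 := by
  rw [sum_hsForm_noise_noise, map_add (hsForm r.N), LinearMap.add_apply, Matrix.mul_smul,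
    hsForm_real_smul_left, hsForm_mul_left_eq_zero_of_mem_lieAlg r hA, mul_zero, zero_add]
  ring

/-- In particular for the TRUE drift of (⋆): `2⟨(driftLie + C_𝔤) Q_e, Q_e⟩ + Σₙ ‖σ_{e,n}(Q)‖² = 0`.
[folklore] -/
theorem two_hsForm_langevinDrift_add_sum_noise_sq_eq_zero {d L : ℕ} (β : ℝ)
    (Q : MatrixConfig d L r.N) (e : Edge d L) :
    2 * hsForm r.N ((latticeLangevinDynamics r β).drift Q e) (Q e) +
      ∑ n : NoiseIdx r.N, hsForm r.N ((latticeLangevinDynamics r β).noise Q e n)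
        ((latticeLangevinDynamics r β).noise Q e n) = 0 := by
  have h := two_hsForm_drift_add_sum_noise_sq_eq_zero r β Q e (r.driftLie_mem_lieAlg β Q e) 1
  rwa [one_smul, ← Matrix.add_mul, ← latticeLangevinDynamics_drift] at h

end Tangency

end Summit.QuantumFields.YangMills.Theorems.ColdStartUniversality

end
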